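import Literature.Algebra.EuclideanLattices.MRLemma510Dual
import Literature.Computability.Complexity.CodeFPStrings
import HarnessLib

/-!
# Micciancio–Regev 2007, Thm. 5.9 at machine level from its single attempt: the guess-and-verify shell

Topic `Algebra/EuclideanLattices` (family `pqc`). After `MRLemma510Dual.lean` the named fact
`Literature.Computability.Cryptography.owfExist_of_gapSVP_worstCaseHard` follows from ONE inline
hypothesis, MR07 Thm. 5.9 at machine level (`H59`: a PPT solver of well-formed integer `IncGDD` instances
`MRLemma510.IncGDDInst` under the promise `r > g(n) η_{2⁻ⁿ}(L(U))`). The printed proof of Thm. 5.9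
(authors' version pp. 22–24) has an OUTER structure independent of the lattice machinery: the reduction
does not know the index and value `(j, α)` of a nonzero coordinate of the oracle's future answer, so it
"applies the reduction for each of the `2mβ` possible guesses" and outputs the first candidate `s` that
VERIFIES `‖s − t‖ ≤ ‖S‖/g + r` ("such a vector is found with probability at least that of the correct
guess"). This file realises that shell once and for all, so that only the single ATTEMPT for a known guess
(steps 2–4: sampling, the query `A`, combining, `s = x − Yz`) remains to be built:

* `testGood` — the EXACT rational test for `‖zU − t‖ ≤ √A/8 + r` (`A = ‖S‖² ∈ ℤ`): with
  `L = ‖zU − t‖² − A/64 − r²`, accept iff `L ≤ 0 ∨ L² ≤ r²A/16`, cleared of denominators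
  (`testGood_eq_true_iff`, `testGood_readVec_eq_true_iff`: on well-formed instances a string passes iff it
  is a good answer of MR07 Def. 5.6);
* `guessField`, `attInput`, `answers`, `solOut` — attempt `i ≤ Gℓ` is run on `⟨code J, ⟨1ⁱ, 1^{2(Gℓ−i)}⟩⟩`
  (constant input length, hence a constant coin budget) with the `i`-th coin word; the first verified answer
  is output (`solOut_mem_goodAnswers`: some attempt good ⇒ output good);
* `pr_att_le_toReal_solOut` — over uniform coins `Pr[output good] ≥ Pr[attempt i good]` for every guess `i`
  (the `i`-th chunk of a uniform string is uniform: `CoinBlockLaws`, `toOuterMeasure_indepLaw_pi`);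
* `answers_codeFP`, `solOut_codeFP` — the shell is typed polynomial time for an attempt computed on codes;
* **`solver_of_attempt`** — a PPT attempt with a polynomial coin budget that answers well with probability
  `≥ p(J)` for SOME guess `i < G(n)` yields a PPT solver (coin budget `pA(2ℓ+2G(ℓ)+4)·(G(ℓ)+1)`) answering
  well with probability `≥ p(J)`;
* **`incGDDMachine_of_attempt`** (`H59a ⇒ H59`), **`owfExist_of_gapSVP_worstCaseHard_of_incGDDAttempt`**
  and its dual-form version `…_of_dualIncGDDAttempt` — the target fact from the machine-level ATTEMPT alone.

All proved; definitions with bodies; no named fact.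

## References

* D. Micciancio, O. Regev, *Worst-case to average-case reductions based on Gaussian measures*,
  SIAM J. Comput. 37 (2007) 267–302; authors' version (`lit read doi:10.1137/S0097539705447360`),
  Def. 5.6 (p. 19), Thm. 5.9 and its proof (pp. 22–24: the guesses `(j, α)`, the verification), Cor. 5.13,
  Thm. 5.23 (proof, first step, p. 29).
* S. Arora, B. Barak, *Computational Complexity: A Modern Approach*, CUP 2009, §1.3, Def. 7.1 [AroraBarak2009].
* M. Ajtai, *Generating hard instances of lattice problems*, STOC 1996, Thm. 1.
-/

noncomputable section

namespace Literature.Algebra.EuclideanLattices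

namespace MRThm59

open Literature.Computability.Complexity Literature.Computability.Complexity.CodeFP
  Literature.Computability.Complexity.Brick Literature.Computability.Complexity.LMat GSInverse Polynomial
  Literature.Computability.Cryptography Literature.Computability.Cryptography.LWE Literature.Probability.Distributions
  MRLemma510 MeasureTheory PMF
open scoped ENNReal RealInnerProductSpace

/-! ### The exact acceptance test `‖zU − t‖ ≤ ‖S‖/8 + r` -/

/-- The numerator `Lnum = 64 rd² ‖td·zU − tw‖² − td² rd² A − 64 td² rn²` of
`L = ‖zU − t‖² − A/64 − r²` over the common denominator `64 td² rd²`. [folklore] -/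
def lNum (J : IncGDDInst) (z : List ℤ) : ℤ :=
  64 * (J.rd : ℤ) ^ 2 * sqNormZ (subZ J.n (smulZ J.td (vecMulZ J.n z J.U)) J.tw) -
    (J.td : ℤ) ^ 2 * (J.rd : ℤ) ^ 2 * J.maxSqNorm - 64 * (J.td : ℤ) ^ 2 * (J.rn : ℤ) ^ 2

/-- **The exact rational test for `‖zU − t‖ ≤ √A/8 + r`** (`A = ‖S‖²`): with `L = ‖zU − t‖² − A/64 − r²`,
`‖zU − t‖ ≤ √A/8 + r ↔ L ≤ 0 ∨ L² ≤ r²A/16`; over the denominator `64 td² rd²` both are integer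
inequalities. [cite: MicciancioRegev2007, Thm. 5.9 (proof, p. 23: "check whether s − t has norm at most ‖S‖/g + r")] -/
def testGood (J : IncGDDInst) (z : List ℤ) : Bool :=
  decide (z.length = J.n) &&
    (decide (lNum J z ≤ 0) ||
      decide (16 * (J.rd : ℤ) ^ 2 * lNum J z ^ 2 ≤
        (J.rn : ℤ) ^ 2 * J.maxSqNorm * (64 * (J.td : ℤ) ^ 2 * (J.rd : ℤ) ^ 2) ^ 2))

/-- `x ≤ a + r ↔ L ≤ 0 ∨ L² ≤ 4a²r²` for `x, a, r ≥ 0`, `L = x² − a² − r²`. [folklore] -/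
theorem le_add_iff_sq {x a r : ℝ} (hx : 0 ≤ x) (ha : 0 ≤ a) (hr : 0 ≤ r) :
    x ≤ a + r ↔ (x ^ 2 - a ^ 2 - r ^ 2 ≤ 0 ∨ (x ^ 2 - a ^ 2 - r ^ 2) ^ 2 ≤ 4 * a ^ 2 * r ^ 2) := by
  constructor
  · intro h
    by_cases hL : x ^ 2 - a ^ 2 - r ^ 2 ≤ 0
    · exact Or.inl hL
    · right
      push Not at hL
      have h2 : x ^ 2 - a ^ 2 - r ^ 2 ≤ 2 * a * r := by nlinarith
      nlinarith
  · rintro (hL | hL)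
    · nlinarith [sq_nonneg (a + r), mul_nonneg ha hr]
    · by_contra h
      push Not at h
      have h1 : 2 * a * r < x ^ 2 - a ^ 2 - r ^ 2 := by nlinarith [mul_nonneg ha hr]
      have h0 : 0 ≤ 2 * a * r := by positivity
      nlinarith

/-- `A = ‖S‖² ≥ 0`. [folklore] -/
theorem roundA_nonneg (V : List (List ℤ)) : 0 ≤ roundA V := by
  unfold roundA
  rw [List.getD_eq_getElem?_getD]
  cases h : (sqNorms V)[roundIdx V]? with
  | none => simp
  | some a =>
    simp only [Option.getD_some]
    obtain ⟨k, hk, rfl⟩ := List.mem_iff_getElem.1 (List.mem_of_getElem? h)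
    simp only [sqNorms, List.getElem_map]
    exact sqNormZ_nonneg _

/-- **The test is exact**: for a well-formed instance and an answer of length `n`,
`testGood J z ↔ ‖zU − t‖ ≤ ‖S‖/8 + r`. [cite: MicciancioRegev2007, Thm. 5.9 (proof, p. 23), Def. 5.6] -/
theorem testGood_eq_true_iff {J : IncGDDInst} (hJ : J.WellFormed) {z : List ℤ} (hz : z.length = J.n) :
    testGood J z = true ↔
      ‖IncGDDInst.vecOf J.n (vecMulZ J.n z J.U) - J.target‖ ≤ J.maxNorm / 8 + J.radius := by
  have htd : (0 : ℝ) < J.td := by exact_mod_cast hJ.td_pos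
  have hrd : (0 : ℝ) < J.rd := by exact_mod_cast hJ.rd_pos
  have hA0 : (0 : ℝ) ≤ (J.maxSqNorm : ℝ) := by exact_mod_cast roundA_nonneg J.V
  set u := IncGDDInst.vecOf J.n (vecMulZ J.n z J.U) with hu
  set x := ‖u - J.target‖ with hx
  set a := J.maxNorm / 8 with ha
  set r := J.radius with hr
  have hx0 : 0 ≤ x := norm_nonneg _
  have ha0 : 0 ≤ a := by rw [ha]; have := Real.sqrt_nonneg (J.maxSqNorm : ℝ); unfold IncGDDInst.maxNorm; positivity
  have hr0 : 0 ≤ r := by rw [hr]; unfold IncGDDInst.radius; positivity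
  -- the squared distance: `P = td² x²`
  have hP : (sqNormZ (subZ J.n (smulZ J.td (vecMulZ J.n z J.U)) J.tw) : ℝ) = (J.td : ℝ) ^ 2 * x ^ 2 := by
    rw [cast_sqNormZ (n := J.n) (by rw [length_subZ]), vecOf_subZ, vecOf_smulZ]
    have hsub : ((J.td : ℤ) : ℝ) • u - IncGDDInst.vecOf J.n J.tw = (J.td : ℝ) • (u - J.target) := by
      rw [IncGDDInst.target, smul_sub, smul_smul, mul_inv_cancel₀ htd.ne', one_smul]
      norm_cast
    rw [← hu, hsub, norm_smul, Real.norm_eq_abs, abs_of_pos htd, mul_pow]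
  have ha2 : a ^ 2 = (J.maxSqNorm : ℝ) / 64 := by
    rw [ha, IncGDDInst.maxNorm, div_pow, Real.sq_sqrt hA0]; norm_num
  have hrv : r = (J.rn : ℝ) / J.rd := rfl
  -- `L = lNum / (64 td² rd²)`
  set D : ℝ := 64 * (J.td : ℝ) ^ 2 * (J.rd : ℝ) ^ 2 with hD
  have hDpos : 0 < D := by positivity
  have hL : x ^ 2 - a ^ 2 - r ^ 2 = (lNum J z : ℝ) / D := by
    rw [lNum]; push_cast; rw [hP, ha2, hrv, hD]
    field_simp
  rw [testGood, hz, decide_eq_true rfl, Bool.true_and, Bool.or_eq_true, decide_eq_true_iff, decide_eq_true_iff,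
    le_add_iff_sq hx0 ha0 hr0]
  -- compare the two disjuncts
  have h1 : lNum J z ≤ 0 ↔ x ^ 2 - a ^ 2 - r ^ 2 ≤ 0 := by
    rw [hL, div_nonpos_iff]
    constructor
    · intro h; exact Or.inr ⟨by exact_mod_cast h, hDpos.le⟩
    · rintro (⟨h1, h2⟩ | ⟨h1, h2⟩)
      · exfalso; linarith
      · exact_mod_cast h1
  have h2 : 16 * (J.rd : ℤ) ^ 2 * lNum J z ^ 2 ≤ (J.rn : ℤ) ^ 2 * J.maxSqNorm * (64 * (J.td : ℤ) ^ 2 * (J.rd : ℤ) ^ 2) ^ 2 ↔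
      (x ^ 2 - a ^ 2 - r ^ 2) ^ 2 ≤ 4 * a ^ 2 * r ^ 2 := by
    rw [hL, ha2, hrv, div_pow]
    rw [show 4 * ((J.maxSqNorm : ℝ) / 64) * ((J.rn : ℝ) / J.rd) ^ 2 =
        ((J.rn : ℝ) ^ 2 * J.maxSqNorm * D ^ 2 / (16 * (J.rd : ℝ) ^ 2)) / D ^ 2 by
      rw [hD]; field_simp; ring]
    rw [div_le_div_iff_of_pos_right (by positivity), le_div_iff₀ (by positivity)]
    constructor
    · intro h
      have h' : ((16 * (J.rd : ℤ) ^ 2 * lNum J z ^ 2 : ℤ) : ℝ) ≤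
          (((J.rn : ℤ) ^ 2 * J.maxSqNorm * (64 * (J.td : ℤ) ^ 2 * (J.rd : ℤ) ^ 2) ^ 2 : ℤ) : ℝ) := by exact_mod_cast h
      push_cast at h'
      rw [hD]; linarith
    · intro h
      have h' : ((16 * (J.rd : ℤ) ^ 2 * lNum J z ^ 2 : ℤ) : ℝ) ≤
          (((J.rn : ℤ) ^ 2 * J.maxSqNorm * (64 * (J.td : ℤ) ^ 2 * (J.rd : ℤ) ^ 2) ^ 2 : ℤ) : ℝ) := by
        push_cast; rw [hD] at h; linarith
      exact_mod_cast h'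
  rw [h1, h2]

/-- **An answer string passes the test iff it is a good answer** (MR07 Def. 5.6 with `g = 8`), for a
well-formed instance. [cite: MicciancioRegev2007, Def. 5.6, Thm. 5.9 (proof, p. 23)] -/
theorem testGood_readVec_eq_true_iff {J : IncGDDInst} (hJ : J.WellFormed) (a : List Bool) :
    testGood J (readVec a) = true ↔ a ∈ J.goodAnswers := by
  by_cases hz : (readVec a).length = J.n
  · rw [testGood_eq_true_iff hJ hz]
    exact ⟨fun h => ⟨hz, h⟩, fun h => h.2⟩
  · constructor
    · intro h
      rw [testGood, Bool.and_eq_true, decide_eq_true_iff] at h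
      exact absurd h.1 hz
    · intro h; exact absurd h.1 hz


/-! ### The solver shell: try every guess, output the first verified answer -/

/-- **The guess field** `⟨1ⁱ, 1^{2(Gℓ − i)}⟩`, of constant length `2Gℓ + 2` for `i ≤ Gℓ`. [folklore] -/
def guessField (Gℓ i : ℕ) : List Bool := boolPair (unE i) (unE (2 * (Gℓ - i)))

/-- **The input of attempt `i`**: `⟨code J, guess field⟩`. [cite: MicciancioRegev2007, Thm. 5.9 (proof, p. 22: "for each of the 2mβ possible guesses")] -/
def attInput (x : List Bool) (Gℓ i : ℕ) : List Bool := boolPair x (guessField Gℓ i)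

/-- The guess field has constant length. [folklore] -/
theorem length_guessField {Gℓ i : ℕ} (h : i ≤ Gℓ) : (guessField Gℓ i).length = 2 * Gℓ + 2 := by
  simp [guessField, length_unE]; omega

/-- The attempt inputs have constant length `2|x| + 2Gℓ + 4`. [folklore] -/
theorem length_attInput (x : List Bool) {Gℓ i : ℕ} (h : i ≤ Gℓ) : (attInput x Gℓ i).length = 2 * x.length + 2 + (2 * Gℓ + 2) := by
  rw [attInput, length_boolPair, length_guessField h]

/-- **The answers of all guesses** `i ≤ Gℓ`, attempt `i` run with the `i`-th coin word of width `K`.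
[cite: MicciancioRegev2007, Thm. 5.9 (proof, p. 22: "we apply the reduction for each guess")] -/
def answers (att : List Bool → List Bool → List Bool) (J : IncGDDInst) (Gℓ K : ℕ) (r : List Bool) : List (List Bool) :=
  (List.range (Gℓ + 1)).map fun i => att (attInput J.encode Gℓ i) (chunk K r i)

/-- **The solver's output**: the first answer passing the exact test, re-coded as a row of integers (or the
empty string). [cite: MicciancioRegev2007, Thm. 5.9 (proof, p. 23: "if s − t has norm at most … output s")] -/
def solOut (att : List Bool → List Bool → List Bool) (J : IncGDDInst) (Gℓ K : ℕ) (r : List Bool) : List Bool :=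
  match (answers att J Gℓ K r).find? (fun a => testGood J (readVec a)) with
  | some a => rawE intE (readVec a)
  | none => []

/-- Re-coding a read answer does not change its reading. [folklore] -/
theorem rawE_readVec_mem_goodAnswers_iff (J : IncGDDInst) (a : List Bool) :
    rawE intE (readVec a) ∈ J.goodAnswers ↔ a ∈ J.goodAnswers := by
  simp only [IncGDDInst.goodAnswers, Set.mem_setOf_eq, readVec_rawE]

/-- **Verification makes the shell correct**: if SOME attempt `i ≤ Gℓ` returns a good answer, the solver
outputs a good answer (the first verified one; the test is exact on well-formed instances).
[cite: MicciancioRegev2007, Thm. 5.9 (proof, pp. 22–23)] -/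
theorem solOut_mem_goodAnswers {att : List Bool → List Bool → List Bool} {J : IncGDDInst} (hJ : J.WellFormed)
    {Gℓ K : ℕ} {r : List Bool} {i : ℕ} (hi : i ≤ Gℓ)
    (hgood : att (attInput J.encode Gℓ i) (chunk K r i) ∈ J.goodAnswers) :
    solOut att J Gℓ K r ∈ J.goodAnswers := by
  unfold solOut
  have hmem : att (attInput J.encode Gℓ i) (chunk K r i) ∈ answers att J Gℓ K r :=
    List.mem_map.2 ⟨i, List.mem_range.2 (Nat.lt_succ_of_le hi), rfl⟩
  cases hf : (answers att J Gℓ K r).find? (fun a => testGood J (readVec a)) with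
  | none =>
    exfalso
    have h := List.find?_eq_none.1 hf _ hmem
    simp only [Bool.not_eq_true] at h
    have h2 := (testGood_readVec_eq_true_iff hJ _).2 hgood
    rw [h] at h2
    exact Bool.false_ne_true h2
  | some a =>
    simp only
    rw [rawE_readVec_mem_goodAnswers_iff]
    exact (testGood_readVec_eq_true_iff hJ a).1 (by simpa using List.find?_some hf)

/-! ### The law: the solver succeeds at least as often as the true guess's attempt -/

/-- **`Pr[solver good] ≥ Pr[attempt i good]`** for every `i ≤ Gℓ`, over uniform coins of length
`C ≥ K(Gℓ + 1)`, when `K` is the attempt's coin budget on its input (the `i`-th chunk of a uniform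
string is uniform). [cite: MicciancioRegev2007, Thm. 5.9 (proof, p. 22: "the success probability … is at least that of the correct guess")] -/
theorem pr_att_le_toReal_solOut (Att : RandAlg (List Bool) (List Bool)) {J : IncGDDInst} (hJ : J.WellFormed)
    {Gℓ K C : ℕ} (hC : K * (Gℓ + 1) ≤ C) {i : ℕ} (hi : i ≤ Gℓ)
    (hK : Att.coinLen (attInput J.encode Gℓ i).length = K) :
    Att.pr id (attInput J.encode Gℓ i) J.goodAnswers ≤
      (((uniformOfFintype (List.Vector Bool C)).map fun r => solOut Att.run J Gℓ K r.toList).toOuterMeasure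
        J.goodAnswers).toReal := by
  classical
  set inp := attInput J.encode Gℓ i with hinp
  -- the event "attempt `i` is good" as a product event on the chunks
  set A : Fin (Gℓ + 1) → Set (List.Vector Bool K) := fun j =>
    if (j : ℕ) = i then {v | Att.run inp v.toList ∈ J.goodAnswers} else Set.univ with hA
  have hsub : (chunks K (Gℓ + 1) hC) ⁻¹' {w | ∀ j, w j ∈ A j} ⊆
      (fun r : List.Vector Bool C => solOut Att.run J Gℓ K r.toList) ⁻¹' J.goodAnswers := by
    intro r hr
    simp only [Set.mem_preimage, Set.mem_setOf_eq] at hr ⊢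
    have h := hr ⟨i, Nat.lt_succ_of_le hi⟩
    simp only [hA, if_pos rfl, Set.mem_setOf_eq, toList_chunks] at h
    exact solOut_mem_goodAnswers hJ hi h
  have hmono := measure_mono (μ := (uniformOfFintype (List.Vector Bool C)).toOuterMeasure) hsub
  rw [PMF.toOuterMeasure_map_apply]
  refine le_trans (le_of_eq ?_) (ENNReal.toReal_mono (toOuterMeasure_ne_top' _ _) hmono)
  -- the product event has mass `Pr[attempt i good] · ∏_{j ≠ i} 1`
  rw [← PMF.toOuterMeasure_map_apply, uniformVector_map_chunks_eq_indepLaw, toOuterMeasure_indepLaw_pi,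
    Finset.prod_eq_single (⟨i, Nat.lt_succ_of_le hi⟩ : Fin (Gℓ + 1))]
  · simp only [hA, if_pos rfl]
    have hout : Att.outputPMF id inp = (uniformOfFintype (List.Vector Bool K)).map fun w => Att.run inp w.toList :=
      map_uniformVector_toList_congr (Att.run inp) hK
    rw [RandAlg.pr, hout, PMF.toOuterMeasure_map_apply]
    rfl
  · intro j _ hj
    have : (j : ℕ) ≠ i := fun h => hj (Fin.ext h)
    simp only [hA, if_neg this]
    exact (PMF.toOuterMeasure_apply_eq_one_iff _ _).2 (Set.subset_univ _)
  · intro h; exact absurd (Finset.mem_univ _) h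

/-! ### The shell on codes -/

/-- Reading the tuple of an instance off its code. [folklore] -/
theorem instTup : CodeFP IncGDDInst.encode IncGDDInst.tupleE IncGDDInst.tuple := transparent fun _ => rfl

/-- `lNum` on codes. [cite: AroraBarak2009, §1.3] -/
theorem lNum_codeFP : CodeFP (pairE IncGDDInst.encode (rawE intE)) intE (fun p => lNum p.1 p.2) := by
  have hJ : CodeFP (pairE IncGDDInst.encode (rawE intE)) IncGDDInst.tupleE (fun p => p.1.tuple) := (instTup.comp (fst _ _) :)
  have hz : CodeFP (pairE IncGDDInst.encode (rawE intE)) (rawE intE) (fun p => p.2) := (snd _ _ :)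
  have hn : CodeFP (pairE IncGDDInst.encode (rawE intE)) unE (fun p => p.1.n) := (hJ.fst'.fst' :)
  have hU : CodeFP (pairE IncGDDInst.encode (rawE intE)) matE (fun p => p.1.U) := (hJ.fst'.snd' :)
  have hV : CodeFP (pairE IncGDDInst.encode (rawE intE)) matE (fun p => p.1.V) := (hJ.snd'.fst' :)
  have htw : CodeFP (pairE IncGDDInst.encode (rawE intE)) (rawE intE) (fun p => p.1.tw) := (hJ.snd'.snd'.fst'.fst' :)
  have htd : CodeFP (pairE IncGDDInst.encode (rawE intE)) intE (fun p => (p.1.td : ℤ)) := (intOfNat.comp hJ.snd'.snd'.fst'.snd' :)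
  have hrn : CodeFP (pairE IncGDDInst.encode (rawE intE)) intE (fun p => (p.1.rn : ℤ)) :=
    (intOfNat.comp hJ.snd'.snd'.snd'.fst'.fst' :)
  have hrd : CodeFP (pairE IncGDDInst.encode (rawE intE)) intE (fun p => (p.1.rd : ℤ)) :=
    (intOfNat.comp hJ.snd'.snd'.snd'.fst'.snd' :)
  have hA : CodeFP (pairE IncGDDInst.encode (rawE intE)) intE (fun p => p.1.maxSqNorm) := (roundA_codeFP.comp hV :)
  have hu : CodeFP (pairE IncGDDInst.encode (rawE intE)) (rawE intE) (fun p => vecMulZ p.1.n p.2 p.1.U) :=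
    (vecMulZ_codeFP.comp (hn.pair (hz.pair hU)) :)
  have hP : CodeFP (pairE IncGDDInst.encode (rawE intE)) intE
      (fun p => sqNormZ (subZ p.1.n (smulZ p.1.td (vecMulZ p.1.n p.2 p.1.U)) p.1.tw)) :=
    (sqNormZ_codeFP.comp (subZ_codeFP.comp (hn.pair ((smulZ_codeFP.comp (htd.pair hu)).pair htw))) :)
  have hsq : CodeFP intE intE (fun z : ℤ => z ^ 2) := (intMul.comp ((CodeFP.id _).pair (CodeFP.id _))).congr fun z => (sq z).symm
  have htd2 := (hsq.comp htd :)
  have hrd2 := (hsq.comp hrd :)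
  have hrn2 := (hsq.comp hrn :)
  have h1 : CodeFP (pairE IncGDDInst.encode (rawE intE)) intE
      (fun p => 64 * (p.1.rd : ℤ) ^ 2 * sqNormZ (subZ p.1.n (smulZ p.1.td (vecMulZ p.1.n p.2 p.1.U)) p.1.tw)) :=
    (intMul.comp ((intMul.comp ((const _ (64 : ℤ)).pair hrd2)).pair hP) :)
  have h2 : CodeFP (pairE IncGDDInst.encode (rawE intE)) intE (fun p => (p.1.td : ℤ) ^ 2 * (p.1.rd : ℤ) ^ 2 * p.1.maxSqNorm) :=
    (intMul.comp ((intMul.comp (htd2.pair hrd2)).pair hA) :)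
  have h3 : CodeFP (pairE IncGDDInst.encode (rawE intE)) intE (fun p => 64 * (p.1.td : ℤ) ^ 2 * (p.1.rn : ℤ) ^ 2) :=
    (intMul.comp ((intMul.comp ((const _ (64 : ℤ)).pair htd2)).pair hrn2) :)
  exact ((intSub.comp ((intSub.comp (h1.pair h2)).pair h3)) :)

/-- **The exact test on codes.** [cite: AroraBarak2009, §1.3] -/
theorem testGood_codeFP : CodeFP (pairE IncGDDInst.encode (rawE intE)) bitE (fun p => testGood p.1 p.2) := by
  have hJ : CodeFP (pairE IncGDDInst.encode (rawE intE)) IncGDDInst.tupleE (fun p => p.1.tuple) := (instTup.comp (fst _ _) :)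
  have hz : CodeFP (pairE IncGDDInst.encode (rawE intE)) (rawE intE) (fun p => p.2) := (snd _ _ :)
  have hn : CodeFP (pairE IncGDDInst.encode (rawE intE)) unE (fun p => p.1.n) := (hJ.fst'.fst' :)
  have hV : CodeFP (pairE IncGDDInst.encode (rawE intE)) matE (fun p => p.1.V) := (hJ.snd'.fst' :)
  have htd : CodeFP (pairE IncGDDInst.encode (rawE intE)) intE (fun p => (p.1.td : ℤ)) := (intOfNat.comp hJ.snd'.snd'.fst'.snd' :)
  have hrn : CodeFP (pairE IncGDDInst.encode (rawE intE)) intE (fun p => (p.1.rn : ℤ)) :=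
    (intOfNat.comp hJ.snd'.snd'.snd'.fst'.fst' :)
  have hrd : CodeFP (pairE IncGDDInst.encode (rawE intE)) intE (fun p => (p.1.rd : ℤ)) :=
    (intOfNat.comp hJ.snd'.snd'.snd'.fst'.snd' :)
  have hA : CodeFP (pairE IncGDDInst.encode (rawE intE)) intE (fun p => p.1.maxSqNorm) := (roundA_codeFP.comp hV :)
  have hsq : CodeFP intE intE (fun z : ℤ => z ^ 2) := (intMul.comp ((CodeFP.id _).pair (CodeFP.id _))).congr fun z => (sq z).symm
  have hlen : CodeFP (pairE IncGDDInst.encode (rawE intE)) bitE (fun p => decide (p.2.length = p.1.n)) :=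
    ((CodeFP.eq unE_injective).comp (((ulength intE).comp hz).pair hn) :)
  have hL := (lNum_codeFP :)
  have hc1 : CodeFP (pairE IncGDDInst.encode (rawE intE)) bitE (fun p => decide (lNum p.1 p.2 ≤ 0)) :=
    (intLe.comp (hL.pair (const _ (0 : ℤ))) :)
  have hlhs : CodeFP (pairE IncGDDInst.encode (rawE intE)) intE (fun p => 16 * (p.1.rd : ℤ) ^ 2 * lNum p.1 p.2 ^ 2) :=
    (intMul.comp ((intMul.comp ((const _ (16 : ℤ)).pair (hsq.comp hrd))).pair (hsq.comp hL)) :)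
  have hrhs : CodeFP (pairE IncGDDInst.encode (rawE intE)) intE
      (fun p => (p.1.rn : ℤ) ^ 2 * p.1.maxSqNorm * (64 * (p.1.td : ℤ) ^ 2 * (p.1.rd : ℤ) ^ 2) ^ 2) :=
    (intMul.comp ((intMul.comp ((hsq.comp hrn).pair hA)).pair
      (hsq.comp (intMul.comp ((intMul.comp ((const _ (64 : ℤ)).pair (hsq.comp htd))).pair (hsq.comp hrd))))) :)
  have hc2 : CodeFP (pairE IncGDDInst.encode (rawE intE)) bitE
      (fun p => decide (16 * (p.1.rd : ℤ) ^ 2 * lNum p.1 p.2 ^ 2 ≤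
        (p.1.rn : ℤ) ^ 2 * p.1.maxSqNorm * (64 * (p.1.td : ℤ) ^ 2 * (p.1.rd : ℤ) ^ 2) ^ 2)) := (intLe.comp (hlhs.pair hrhs) :)
  exact ((hlen.and (hc1.or hc2)) :)

/-- The code of the shell's input `(J, ((Gℓ, K), r))`. [folklore] -/
abbrev shellInE : IncGDDInst × ((ℕ × ℕ) × List Bool) → List Bool := pairE IncGDDInst.encode (pairE (pairE unE unE) strE)

variable {att : List Bool → List Bool → List Bool}

/-- **The answers on codes**: a `map` over the guesses `i ≤ Gℓ` of the attempt on
`⟨code J, ⟨1ⁱ, 1^{2(Gℓ−i)}⟩⟩` with the `i`-th coin word. [cite: AroraBarak2009, §1.3] -/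
theorem answers_codeFP (hatt : CodeFP (pairE strE strE) strE (fun q => att q.1 q.2)) :
    CodeFP shellInE (rawE strE) (fun p => answers att p.1 p.2.1.1 p.2.1.2 p.2.2) := by
  -- context `σ = ((code J, Gℓ), (K, r))`, item `i : ℕ` (binary, from `urange`), read in unary as `min i (Gℓ+1)`
  have hx : CodeFP (pairE (pairE (pairE strE unE) (pairE unE strE)) natE) strE (fun q => q.1.1.1) := ((fst _ _).fst'.fst' :)
  have hG : CodeFP (pairE (pairE (pairE strE unE) (pairE unE strE)) natE) unE (fun q => q.1.1.2) := ((fst _ _).fst'.snd' :)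
  have hK : CodeFP (pairE (pairE (pairE strE unE) (pairE unE strE)) natE) unE (fun q => q.1.2.1) := ((fst _ _).snd'.fst' :)
  have hr : CodeFP (pairE (pairE (pairE strE unE) (pairE unE strE)) natE) strE (fun q => q.1.2.2) := ((fst _ _).snd'.snd' :)
  have hi : CodeFP (pairE (pairE (pairE strE unE) (pairE unE strE)) natE) unE (fun q => min q.2 (q.1.1.2 + 1)) :=
    (unOfNatMin.comp ((unSucc.comp hG).pair (snd _ _)) :)
  -- `Gℓ − i` in unary (capped conversion, exact as `Gℓ − i ≤ Gℓ`)
  have hsub : CodeFP (pairE (pairE (pairE strE unE) (pairE unE strE)) natE) unE (fun q => q.1.1.2 - min q.2 (q.1.1.2 + 1)) :=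
    (unOfNatMin.comp (hG.pair (natSub.comp ((natOfUn.comp hG).pair (natOfUn.comp hi))))).congr fun q => by
      simp only [id]; omega
  have hfield : CodeFP (pairE (pairE (pairE strE unE) (pairE unE strE)) natE) strE
      (fun q => guessField q.1.1.2 (min q.2 (q.1.1.2 + 1))) :=
    (((strOfUn.comp hi).pair (strOfUn.comp ((unMulConst 2).comp hsub))).recodeOut fun q => rfl :)
  have hinp : CodeFP (pairE (pairE (pairE strE unE) (pairE unE strE)) natE) strE
      (fun q => attInput q.1.1.1 q.1.1.2 (min q.2 (q.1.1.2 + 1))) := ((hx.pair hfield).recodeOut fun q => rfl :)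
  -- the `i`-th coin word `(r.drop (K i)).take K`
  have hKi : CodeFP (pairE (pairE (pairE strE unE) (pairE unE strE)) natE) unE (fun q => q.1.2.1 * min q.2 (q.1.1.2 + 1)) :=
    ((ulength unitE).comp (unitsMul.comp ((replicateUnit.comp hK).pair (replicateUnit.comp hi)))).congr fun q => by simp
  have hword : CodeFP (pairE (pairE (pairE strE unE) (pairE unE strE)) natE) strE
      (fun q => chunk q.1.2.1 q.1.2.2 (min q.2 (q.1.1.2 + 1))) :=
    ((strTake.comp (hK.pair (strDrop.comp (hKi.pair hr)))).congr fun q => rfl :)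
  have hitem : CodeFP (pairE (pairE (pairE strE unE) (pairE unE strE)) natE) strE
      (fun q => att (attInput q.1.1.1 q.1.1.2 (min q.2 (q.1.1.2 + 1))) (chunk q.1.2.1 q.1.2.2 (min q.2 (q.1.1.2 + 1)))) :=
    (hatt.comp (hinp.pair hword) :)
  -- assemble: the context from the shell's input, and the range `[0, Gℓ]`
  have hJs : CodeFP shellInE strE (fun p => p.1.encode) := ((CodeFP.id _).fst'.recodeOut fun _ => rfl :)
  have hGs : CodeFP shellInE unE (fun p => p.2.1.1) := ((snd _ _).fst'.fst' :)
  have hKs : CodeFP shellInE unE (fun p => p.2.1.2) := ((snd _ _).fst'.snd' :)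
  have hrs : CodeFP shellInE strE (fun p => p.2.2) := ((snd _ _).snd' :)
  have hctx : CodeFP shellInE (pairE (pairE strE unE) (pairE unE strE)) (fun p => ((p.1.encode, p.2.1.1), (p.2.1.2, p.2.2))) :=
    ((hJs.pair hGs).pair (hKs.pair hrs) :)
  have hrange : CodeFP shellInE (rawE natE) (fun p => List.range (p.2.1.1 + 1)) := (urange.comp (unSucc.comp hGs) :)
  have h := ((CodeFP.map hitem).comp (hctx.pair hrange) :)
  refine h.congr fun p => ?_
  simp only [answers]
  refine List.map_congr_left fun i hi => ?_
  rw [Nat.min_eq_left (List.mem_range.1 hi).le]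

/-- **The solver shell on codes.** [cite: MicciancioRegev2007, Thm. 5.9 ("probabilistic polynomial time reduction"); AroraBarak2009 §1.3] -/
theorem solOut_codeFP (hatt : CodeFP (pairE strE strE) strE (fun q => att q.1 q.2)) :
    CodeFP shellInE strE (fun p => solOut att p.1 p.2.1.1 p.2.1.2 p.2.2) := by
  have hans := (answers_codeFP hatt :)
  have hJ : CodeFP shellInE IncGDDInst.encode (fun p => p.1) := (fst _ _ :)
  -- the test of one answer, context `J`
  have ht : CodeFP (pairE IncGDDInst.encode strE) bitE (fun q => testGood q.1 (readVec q.2)) :=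
    (testGood_codeFP.comp ((fst _ _).pair (readVec_codeFP.comp (snd _ _))) :)
  have hfind := ((rawFind? ht).comp (hJ.pair hans) :)
  -- the case analysis
  have hk := optCases (σ := IncGDDInst) (α := List Bool) (δ := List Bool) (eσ := IncGDDInst.encode) (eα := strE) (eδ := strE)
    (k := fun _ o => match o with | some a => rawE intE (readVec a) | none => [])
    (gnone := fun _ => []) (gsome := fun t => rawE intE (readVec t.2))
    (const _ ([] : List Bool)) (((readVec_codeFP.comp (snd _ _)).recodeOut fun _ => rfl) :) (fun _ => rfl) (fun _ _ => rfl)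
  exact ((hk.comp (hJ.pair hfind)) :)



/-! ### MR07 Thm. 5.9 at machine level from a single-attempt machine -/

/-- **The solver of Thm. 5.9 from its attempt**: given an attempt machine `Att` (PPT, polynomial coin budget)
that, on every well-formed instance `J` satisfying a side condition `P` (e.g. the promise and the dimension
guards), returns a GOOD answer with probability `≥ p J` for SOME guess `i < G(n)` fed as `⟨code J, ⟨1ⁱ, w⟩⟩`
(any filler `w`), the shell `solOut` — run every guess `i ≤ G(ℓ)` with its own coins, output the first
answer passing the exact test — is a PPT solver with a polynomial coin budget succeeding with probability
`≥ p J` on every such `J`. [cite: MicciancioRegev2007, Thm. 5.9 (proof, pp. 22–23: unknown guess `(j, α)`, all `2mβ` guesses tried, output verified)] -/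
theorem solver_of_attempt (Att : RandAlg (List Bool) (List Bool)) (hAtt : IsPPT Att id) {pA : Polynomial ℕ}
    (hpA : ∀ k, Att.coinLen k = pA.eval k) (G : Polynomial ℕ) {P : IncGDDInst → Prop} {p : IncGDDInst → ℝ}
    (hsucc : ∀ J : IncGDDInst, J.WellFormed → P J →
      ∃ i < G.eval J.n, ∀ w : List Bool, p J ≤ Att.pr id (boolPair J.encode (boolPair (unE i) w)) J.goodAnswers) :
    ∃ Sol : RandAlg (List Bool) (List Bool), IsPPT Sol id ∧ (∃ pS : Polynomial ℕ, ∀ k, Sol.coinLen k = pS.eval k) ∧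
      ∀ J : IncGDDInst, J.WellFormed → P J → p J ≤ Sol.pr id J.encode J.goodAnswers := by
  classical
  -- parameters from the input length `ℓ`: `Gℓ = G(ℓ)` guesses, word width `K = pA(2ℓ + 2Gℓ + 4)`
  set pK : Polynomial ℕ := pA.comp (2 * X + 2 + (2 * G + 2)) with hpK
  -- the program `(J, r) ↦ solOut Att.run J (G ℓ) (pK ℓ) r`
  have hatt : CodeFP (pairE strE strE) strE (fun q => Att.run q.1 q.2) :=
    of_fn (Function.uncurry Att.run ∘ boolUnpair) (PolyTimeComputable.comp_holds hAtt.1 polyTimeComputable_boolUnpair)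
      fun q => by simp [pairE, strE, Function.uncurry]
  have hprog : CodeFP (pairE IncGDDInst.encode strE) strE
      (fun q => solOut Att.run q.1 (G.eval q.1.encode.length) (pK.eval q.1.encode.length) q.2) := by
    have hJ : CodeFP (pairE IncGDDInst.encode strE) IncGDDInst.encode (fun q => q.1) := (fst _ _ :)
    have hr : CodeFP (pairE IncGDDInst.encode strE) strE (fun q => q.2) := (snd _ _ :)
    have hself : CodeFP IncGDDInst.encode strE IncGDDInst.encode := (CodeFP.id _).recodeOut fun _ => rfl
    have hℓ : CodeFP (pairE IncGDDInst.encode strE) unE (fun q => q.1.encode.length) := (strLength.comp (hself.comp hJ) :)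
    have hG : CodeFP (pairE IncGDDInst.encode strE) unE (fun q => G.eval q.1.encode.length) := ((unPoly G).comp hℓ :)
    have hKc : CodeFP (pairE IncGDDInst.encode strE) unE (fun q => pK.eval q.1.encode.length) := ((unPoly pK).comp hℓ :)
    exact ((solOut_codeFP hatt).comp (hJ.pair ((hG.pair hKc).pair hr)) :)
  obtain ⟨F, hF, hFeq⟩ := hprog
  let Sol : RandAlg (List Bool) (List Bool) := ⟨fun x r => F (boolPair x r), fun ℓ => (pK * (G + 1)).eval ℓ⟩
  refine ⟨Sol, ⟨?_, ⟨pK * (G + 1), fun ℓ => le_rfl⟩⟩, ⟨pK * (G + 1), fun _ => rfl⟩, fun J hJ hP => ?_⟩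
  · obtain ⟨pc, Mc, hM⟩ := hF
    exact ⟨pc, Mc, fun z => hM (boolPair z.1 z.2)⟩
  -- success on `J`
  obtain ⟨i, hiG, hi⟩ := hsucc J hJ hP
  set ℓ := J.encode.length with hℓ
  set Gℓ := G.eval ℓ with hGℓ
  set K := pK.eval ℓ with hKd
  have hnℓ : J.n ≤ ℓ := by
    rw [hℓ]; change J.n ≤ (IncGDDInst.tupleE J.tuple).length
    simp [IncGDDInst.tuple, length_unE]; omega
  have hiG' : i ≤ Gℓ := (hiG.le.trans (TM2Iter.eval_mono G hnℓ))
  have hK : Att.coinLen (attInput J.encode Gℓ i).length = K := by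
    rw [length_attInput _ hiG', hpA]
    show pA.eval (2 * ℓ + 2 + (2 * Gℓ + 2)) = (pA.comp (2 * X + 2 + (2 * G + 2))).eval ℓ
    rw [eval_comp]
    congr 1
    simp [hGℓ]
  have hC : K * (Gℓ + 1) ≤ Sol.coinLen ℓ := by
    change K * (Gℓ + 1) ≤ (pK * (G + 1)).eval ℓ
    simp [hKd, hGℓ]
  have hrun : ∀ r : List Bool, Sol.run J.encode r = solOut Att.run J Gℓ K r := fun r => hFeq (J, r)
  have hpr : Sol.pr id J.encode J.goodAnswers =
      (((uniformOfFintype (List.Vector Bool (Sol.coinLen ℓ))).map fun r => solOut Att.run J Gℓ K r.toList).toOuterMeasure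
        J.goodAnswers).toReal := by
    rw [RandAlg.pr]
    change (((uniformOfFintype (List.Vector Bool (Sol.coinLen ℓ))).map fun r => Sol.run J.encode r.toList).toOuterMeasure
      J.goodAnswers).toReal = _
    simp only [hrun]
  rw [hpr]
  exact (hi (unE (2 * (Gℓ - i)))).trans (pr_att_le_toReal_solOut Att hJ hC hiG' hK)

/-- **MR07 Thm. 5.9 at machine level (the hypothesis `H59` of
`MRLemma510Dual.shortDual_hypothesis_of_incGDDMachine`) from a machine-level single attempt**: it suffices to
build, from the `SIS′` solver `B`, a PPT attempt `Att` that on every well-formed promise instance of dimension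
`n ∈ S`, `n ≥ n₀` returns a good answer with probability `≥ 1/n^e` for SOME guess `i < G(n)` given to it.
[cite: MicciancioRegev2007, Thm. 5.9 and its proof (pp. 22–24)] -/
theorem incGDDMachine_of_attempt
    (H59a : ∀ (q m : ℕ → ℕ) [∀ n, NeZero (q n)] (β : ℕ → ℝ),
      IsPolyBounded q → IsPolyBounded m → IsPolyBoundedReal β → IsPolyTimeParams q β m →
      (∀ n, 0 < β n) → MRModulusCondition q m β →
      ∀ B : RandAlg (List Bool) (List Bool), IsPPT B id → ∀ (c : ℕ) (S : Set ℕ),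
        (∀ n ∈ S, 1 / (n : ℝ) ^ c ≤ SIS.successProb' B n (m n) (q n) (β n)) →
        ∃ g : ℕ → ℝ, IsPolyBoundedReal g ∧ (∀ n, 0 ≤ g n) ∧
        ∃ Att : RandAlg (List Bool) (List Bool), IsPPT Att id ∧
          (∃ pA : Polynomial ℕ, ∀ k, Att.coinLen k = pA.eval k) ∧ ∃ G : Polynomial ℕ,
          ∃ (e n₀ : ℕ), ∀ J : IncGDDInst, J.WellFormed → J.n ∈ S → n₀ ≤ J.n → J.Promise (g J.n) →
            ∃ i < G.eval J.n, ∀ w : List Bool,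
              1 / (J.n : ℝ) ^ e ≤ Att.pr id (boolPair J.encode (boolPair (unE i) w)) J.goodAnswers)
    (q m : ℕ → ℕ) [∀ n, NeZero (q n)] (β : ℕ → ℝ)
    (hq : IsPolyBounded q) (hm : IsPolyBounded m) (hβ : IsPolyBoundedReal β) (hpar : IsPolyTimeParams q β m)
    (hβ0 : ∀ n, 0 < β n) (hmod : MRModulusCondition q m β)
    (B : RandAlg (List Bool) (List Bool)) (hB : IsPPT B id) (c : ℕ) (S : Set ℕ)
    (hS : ∀ n ∈ S, 1 / (n : ℝ) ^ c ≤ SIS.successProb' B n (m n) (q n) (β n)) :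
    ∃ g : ℕ → ℝ, IsPolyBoundedReal g ∧ (∀ n, 0 ≤ g n) ∧
    ∃ Sol : RandAlg (List Bool) (List Bool), IsPPT Sol id ∧
      (∃ pS : Polynomial ℕ, ∀ k, Sol.coinLen k = pS.eval k) ∧
      ∃ (e n₀ : ℕ), ∀ J : IncGDDInst, J.WellFormed → J.n ∈ S → n₀ ≤ J.n → J.Promise (g J.n) →
        1 / (J.n : ℝ) ^ e ≤ Sol.pr id J.encode J.goodAnswers := by
  obtain ⟨g, hg, hg0, Att, hAtt, ⟨pA, hpA⟩, G, e, n₀, hsucc⟩ := H59a q m β hq hm hβ hpar hβ0 hmod B hB c S hS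
  obtain ⟨Sol, hSol, hpS, h⟩ := solver_of_attempt Att hAtt hpA G
    (P := fun J => J.n ∈ S ∧ n₀ ≤ J.n ∧ J.Promise (g J.n)) (p := fun J => 1 / (J.n : ℝ) ^ e)
    (fun J hJ hP => hsucc J hJ hP.1 hP.2.1 hP.2.2)
  exact ⟨g, hg, hg0, Sol, hSol, hpS, e, n₀, fun J hJ hS' hn hprom => h J hJ ⟨hS', hn, hprom⟩⟩

/-- **The target fact `owfExist_of_gapSVP_worstCaseHard` from a machine-level ATTEMPT of MR07 Thm. 5.9**
(the single run of steps 2–4 of the reduction for a known guess `(j, α)`: sampling on the fine grid of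
`L(S)`, the query `A` to the `SIS′` solver, the combining procedure, `s = x − Yz`), written inline as
`H59a`: the attempt shell `solOut` gives the solver (`incGDDMachine_of_attempt`), the loop of Lemma 5.10
on the integral dual gives Cor. 5.13 (`MRLemma510Dual`), and the verifier-free route closes the target.
[cite: MicciancioRegev2007, Thm. 5.23 (proof, first step, p. 29) with Cor. 5.13, Lemma 5.10, Thm. 5.9; Ajtai 1996 Thm. 1] -/
theorem owfExist_of_gapSVP_worstCaseHard_of_incGDDAttempt
    (H59a : ∀ (q m : ℕ → ℕ) [∀ n, NeZero (q n)] (β : ℕ → ℝ),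
      IsPolyBounded q → IsPolyBounded m → IsPolyBoundedReal β → IsPolyTimeParams q β m →
      (∀ n, 0 < β n) → MRModulusCondition q m β →
      ∀ B : RandAlg (List Bool) (List Bool), IsPPT B id → ∀ (c : ℕ) (S : Set ℕ),
        (∀ n ∈ S, 1 / (n : ℝ) ^ c ≤ SIS.successProb' B n (m n) (q n) (β n)) →
        ∃ g : ℕ → ℝ, IsPolyBoundedReal g ∧ (∀ n, 0 ≤ g n) ∧
        ∃ Att : RandAlg (List Bool) (List Bool), IsPPT Att id ∧
          (∃ pA : Polynomial ℕ, ∀ k, Att.coinLen k = pA.eval k) ∧ ∃ G : Polynomial ℕ,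
          ∃ (e n₀ : ℕ), ∀ J : IncGDDInst, J.WellFormed → J.n ∈ S → n₀ ≤ J.n → J.Promise (g J.n) →
            ∃ i < G.eval J.n, ∀ w : List Bool,
              1 / (J.n : ℝ) ^ e ≤ Att.pr id (boolPair J.encode (boolPair (unE i) w)) J.goodAnswers) :
    owfExist_of_gapSVP_worstCaseHard :=
  owfExist_of_gapSVP_worstCaseHard_of_incGDDMachine fun q m _ β hq hm hβ hpar hβ0 hmod B hB c S hS =>
    incGDDMachine_of_attempt H59a q m β hq hm hβ hpar hβ0 hmod B hB c S hS

/-- **Dual-form version**: the attempt is asked only on instances whose lattice is an integral dual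
`U = dualRows I` (hypothesis of `shortDual_hypothesis_of_dualIncGDDMachine`).
[cite: MicciancioRegev2007, Thm. 5.23 (proof, first step, p. 29) with Cor. 5.13, Lemma 5.10, Thm. 5.9; Ajtai 1996 Thm. 1] -/
theorem owfExist_of_gapSVP_worstCaseHard_of_dualIncGDDAttempt
    (H59a : ∀ (q m : ℕ → ℕ) [∀ n, NeZero (q n)] (β : ℕ → ℝ),
      IsPolyBounded q → IsPolyBounded m → IsPolyBoundedReal β → IsPolyTimeParams q β m →
      (∀ n, 0 < β n) → MRModulusCondition q m β →
      ∀ B : RandAlg (List Bool) (List Bool), IsPPT B id → ∀ (c : ℕ) (S : Set ℕ),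
        (∀ n ∈ S, 1 / (n : ℝ) ^ c ≤ SIS.successProb' B n (m n) (q n) (β n)) →
        ∃ g : ℕ → ℝ, IsPolyBoundedReal g ∧ (∀ n, 0 ≤ g n) ∧
        ∃ Att : RandAlg (List Bool) (List Bool), IsPPT Att id ∧
          (∃ pA : Polynomial ℕ, ∀ k, Att.coinLen k = pA.eval k) ∧ ∃ G : Polynomial ℕ,
          ∃ (e n₀ : ℕ), ∀ I : LatticeInstance, I.IsNonsingular → ∀ J : IncGDDInst, J.WellFormed →
            J.n = I.n → J.U = dualRows I → J.n ∈ S → n₀ ≤ J.n → J.Promise (g J.n) →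
            ∃ i < G.eval J.n, ∀ w : List Bool,
              1 / (J.n : ℝ) ^ e ≤ Att.pr id (boolPair J.encode (boolPair (unE i) w)) J.goodAnswers) :
    owfExist_of_gapSVP_worstCaseHard := by
  refine owfExist_of_gapSVP_worstCaseHard_of_dualIncGDDMachine fun q m _ β hq hm hβ hpar hβ0 hmod B hB c S hS => ?_
  obtain ⟨g, hg, hg0, Att, hAtt, ⟨pA, hpA⟩, G, e, n₀, hsucc⟩ := H59a q m β hq hm hβ hpar hβ0 hmod B hB c S hS
  obtain ⟨Sol, hSol, hpS, h⟩ := solver_of_attempt Att hAtt hpA G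
    (P := fun J => ∃ I : LatticeInstance, I.IsNonsingular ∧ J.n = I.n ∧ J.U = dualRows I ∧ J.n ∈ S ∧ n₀ ≤ J.n ∧ J.Promise (g J.n))
    (p := fun J => 1 / (J.n : ℝ) ^ e)
    (fun J hJ ⟨I, hI, hn, hU, hS', hn0, hprom⟩ => hsucc I hI J hJ hn hU hS' hn0 hprom)
  exact ⟨g, hg, hg0, Sol, hSol, hpS, e, n₀, fun I hI J hJ hn hU hS' hn0 hprom => h J hJ ⟨I, hI, hn, hU, hS', hn0, hprom⟩⟩

end MRThm59

end Literature.Algebra.EuclideanLattices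

end
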